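import Literature.NumberTheory.Transcendental.RoySmallValueStep1Body
import Literature.NumberTheory.Transcendental.RoySmallValueLevelQBody
import Literature.NumberTheory.Transcendental.RoySmallValueLevelHeights
import Literature.NumberTheory.Transcendental.RoySmallValueAsymptotics
import Mathlib.Algebra.Order.Antidiag.FinsuppEquiv
import HarnessLib

/-!
# Roy's small value estimate for `𝔾ₐ × 𝔾ₘ` — preliminaries for the assembly of Theorem 1.1

Topic `Literature/NumberTheory/Transcendental`. Part of the formalisation of the proof of Roy 2013,
Theorem 1.1 (named fact `roy2013_thm_1_1`, `RoySmallValueEstimates.lean`), seat B. Source: D. Roy,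
*A small value estimate for `𝔾ₐ × 𝔾ₘ`*, Mathematika 59 (2013) 333–363 = arXiv:1301.0663, §7,
Steps 1–3 (pp. 18–19).

Small lemmas isolating routine verifications of the assembly (`RoySmallValueMain`):

* `royBody_mono` — Roy's body grows with `Y` and shrinks with `U`;
* `mem_body_of_step1` — Step 1 for the data of Theorem 1.1: from `‖P‖ ≤ e^{n^β}`,
  `|𝒟₁ᵗP(ξ,η)| ≤ e^{−n^ν}` (`t < 3T`) and the two thresholds of `RoySmallValueThresholds`,
  `𝒟ʲP̃_n ∈ royBody n ξ η (2n^β) (n^ν/2) T` for `j ≤ 2T` (`T = ⌊n^τ⌋`);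
* `LevelPkg.one_le_t` — the parameter `t` of `Q = ∑ tⁱ𝒟ⁱP̃` is `≥ 1`;
* `LevelPkg.card_M₁_le` — `#M₁ ≤ binom(2D+2, 2)`;
* `LevelPkg.log_length_intF_le` — `log 𝓛(Φ(P̃,Q,·)) ≤ log N! + N₀ log M_P + #M₁ log M_Q`; `log_factorial_le`;
  `card_phiRow`, `card_antidiag_two`, `card_M₁_le` — `N = binom(3D+2,2)`, `N₀ = binom(2D+2,2) ≥ #M₁`;
* `window_le` — `L ≤ T` on the interpolation window; `choose_window_le` — `binom(L+2,2) ≤ 3T`.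

Everything is proved; no definitions, no named facts.

## References

* [Roy2013] D. Roy, *A small value estimate for 𝔾ₐ × 𝔾ₘ*, Mathematika 59 (2013), 333–363
  (arXiv:1301.0663), §7, Steps 1–3.
-/

noncomputable section

open MvPolynomial Finset Height

namespace Literature.NumberTheory.Transcendental

namespace Roy2013

open Nesterenko

/-! ### Roy's body -/

/-- **Monotonicity of Roy's body** in the parameters. [folklore] -/
theorem royBody_mono {D : ℕ} {ξ η : ℂ} {Y₀ U₀ Y U : ℝ} {T : ℕ} (hY : Y₀ ≤ Y) (hU : U ≤ U₀) {R : CX}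
    (hR : R ∈ royBody D ξ η Y₀ U₀ T) : R ∈ royBody D ξ η Y U T :=
  ⟨hR.1, hR.2.1.trans (Real.exp_le_exp.mpr hY),
    fun i hi => (hR.2.2 i hi).trans (Real.exp_le_exp.mpr (by linarith))⟩

/-- **Step 1 for the data of Theorem 1.1.** [cite: Roy2013, §7, Step 1] -/
theorem mem_body_of_step1 {n : ℕ} {P : MvPolynomial (Fin 2) ℤ} (hP : P ≠ 0)
    (hdeg : P.totalDegree ≤ n) {ξ η : ℂ} (hη : η ≠ 0) {τ β ν : ℝ} (hn : 1 ≤ n) (j : ℕ)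
    (hj : j ≤ 2 * ⌊(n : ℝ) ^ τ⌋₊)
    (hht : (mvPolyHeight P : ℝ) ≤ Real.exp ((n : ℝ) ^ β))
    (hval : ∀ t < 3 * ⌊(n : ℝ) ^ τ⌋₊, ‖aeval ![ξ, η] (royD^[t] P)‖ ≤ Real.exp (-(n : ℝ) ^ ν))
    (E5 : (n : ℝ) ^ (2 * ⌊(n : ℝ) ^ τ⌋₊) * (((n + 1) ^ 2 : ℕ) : ℝ) ≤ Real.exp ((n : ℝ) ^ β))
    (E6 : (2 * n + 1 : ℝ) ^ (3 * ⌊(n : ℝ) ^ τ⌋₊) * (max 1 ‖ξ‖ * max 1 ‖η‖⁻¹) ^ n *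
      Real.exp (-(n : ℝ) ^ ν) ≤ Real.exp (-((n : ℝ) ^ ν / 2))) :
    map (Int.castRingHom ℂ) ((homDK ℤ)^[j] (royTilde n hP)) ∈
      royBody n ξ η (2 * (n : ℝ) ^ β) ((n : ℝ) ^ ν / 2) ⌊(n : ℝ) ^ τ⌋₊ := by
  have hx1 : (1 : ℝ) ≤ n := by exact_mod_cast hn
  refine map_iterate_homDK_royTilde_mem_royBody hP hdeg hη j hht (Real.exp_pos _).le
    (fun t ht => hval t (by omega)) ?_ ?_
  · -- the norm threshold
    have h1 : (n : ℝ) ^ j ≤ (n : ℝ) ^ (2 * ⌊(n : ℝ) ^ τ⌋₊) := pow_le_pow_right₀ hx1 hj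
    have h2 : (0 : ℝ) ≤ (((n + 1) ^ 2 : ℕ) : ℝ) * Real.exp ((n : ℝ) ^ β) := by positivity
    calc (n : ℝ) ^ j * ((((n + 1) ^ 2 : ℕ) : ℝ) * Real.exp ((n : ℝ) ^ β))
        ≤ (n : ℝ) ^ (2 * ⌊(n : ℝ) ^ τ⌋₊) * ((((n + 1) ^ 2 : ℕ) : ℝ) * Real.exp ((n : ℝ) ^ β)) :=
          mul_le_mul_of_nonneg_right h1 h2
      _ = ((n : ℝ) ^ (2 * ⌊(n : ℝ) ^ τ⌋₊) * (((n + 1) ^ 2 : ℕ) : ℝ)) * Real.exp ((n : ℝ) ^ β) := by ring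
      _ ≤ Real.exp ((n : ℝ) ^ β) * Real.exp ((n : ℝ) ^ β) :=
          mul_le_mul_of_nonneg_right E5 (Real.exp_pos _).le
      _ = Real.exp (2 * (n : ℝ) ^ β) := by rw [← Real.exp_add]; ring_nf
  · -- the value threshold
    have hb : (1 : ℝ) ≤ 2 * n + 1 := by linarith
    have h1 : (2 * n + 1 : ℝ) ^ (j + ⌊(n : ℝ) ^ τ⌋₊) ≤ (2 * n + 1 : ℝ) ^ (3 * ⌊(n : ℝ) ^ τ⌋₊) :=
      pow_le_pow_right₀ hb (by omega)
    have hC : max 1 ‖ξ‖ ^ n * max 1 ‖η‖⁻¹ ^ n = (max 1 ‖ξ‖ * max 1 ‖η‖⁻¹) ^ n := (mul_pow _ _ _).symm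
    rw [hC]
    have h2 : (0 : ℝ) ≤ (max 1 ‖ξ‖ * max 1 ‖η‖⁻¹) ^ n * Real.exp (-(n : ℝ) ^ ν) := by positivity
    calc (2 * n + 1 : ℝ) ^ (j + ⌊(n : ℝ) ^ τ⌋₊) * (max 1 ‖ξ‖ * max 1 ‖η‖⁻¹) ^ n * Real.exp (-(n : ℝ) ^ ν)
        = (2 * n + 1 : ℝ) ^ (j + ⌊(n : ℝ) ^ τ⌋₊) * ((max 1 ‖ξ‖ * max 1 ‖η‖⁻¹) ^ n * Real.exp (-(n : ℝ) ^ ν)) := by ring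
      _ ≤ (2 * n + 1 : ℝ) ^ (3 * ⌊(n : ℝ) ^ τ⌋₊) * ((max 1 ‖ξ‖ * max 1 ‖η‖⁻¹) ^ n * Real.exp (-(n : ℝ) ^ ν)) :=
          mul_le_mul_of_nonneg_right h1 h2
      _ = _ := by ring
      _ ≤ _ := E6

/-! ### Packages -/

namespace LevelPkg

variable {D : ℕ} {Pt : MvPolynomial (Fin 3) ℤ} (L : LevelPkg D Pt)

/-- `t ≥ 1` (otherwise `Q = 0`). [folklore] -/
theorem one_le_t : 1 ≤ L.t := by
  by_contra h
  have ht : L.t = 0 := by omega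
  apply L.hQ0
  rw [map_levelQ, ht]
  refine Finset.sum_eq_zero fun i hi => ?_
  have : 1 ≤ i := (mem_Icc.mp hi).1
  rw [Nat.cast_zero, zero_pow (by omega), zero_smul]

/-- `N₀ = binom(2D+2, 2)`. [folklore] -/
theorem card_antidiag_two : Fintype.card ↥(finsuppAntidiag (univ : Finset (Fin 3)) (2 * D)) =
    (2 * D + 2).choose 2 := by
  rw [Fintype.card_coe, Finset.card_finsuppAntidiag_nat_eq_choose, card_univ, Fintype.card_fin,
    show 3 + 2 * D - 1 = 2 * D + 2 by omega, Nat.choose_symm_add]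

/-- `#M₁ ≤ binom(2D+2, 2)`. [folklore] -/
theorem card_M₁_le : Fintype.card ↥L.M₁ ≤ (2 * D + 2).choose 2 := by
  classical
  rw [Fintype.card_coe, ← card_antidiag_two (D := D), Fintype.card_coe]
  refine card_le_card fun μ hμ => ?_
  rw [mem_finsuppAntidiag]
  exact ⟨by rw [← Finsupp.degree_eq_sum]; exact L.hM₁ μ hμ, subset_univ _⟩

/-- `N = binom(3D+2, 2)`. [folklore] -/
theorem card_phiRow : Fintype.card (PhiRow D) = (3 * D + 2).choose 2 := by
  show Fintype.card ↥(finsuppAntidiag (univ : Finset (Fin 3)) (3 * D)) = _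
  rw [Fintype.card_coe, Finset.card_finsuppAntidiag_nat_eq_choose, card_univ, Fintype.card_fin,
    show 3 + 3 * D - 1 = 3 * D + 2 by omega, Nat.choose_symm_add]

/-- **`log 𝓛(Φ(P̃, Q, ·)) ≤ log N! + N₀ log M_P + N₁ log M_Q`** when `‖P̃‖ ≤ M_P`, `‖Q‖ ≤ M_Q`
(`M_P, M_Q ≥ 1`). [cite: Roy2013, §6, proof of Prop. 6.4 (`‖F‖ ≤ N!‖P‖^N‖Q‖^N`)] -/
theorem log_length_intF_le {MP MQ : ℝ} (hMP : 1 ≤ MP) (hMQ : 1 ≤ MQ)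
    (hP : maxNorm (map (Int.castRingHom ℂ) Pt) ≤ MP)
    (hQ : maxNorm (map (Int.castRingHom ℂ) (levelQ D Pt L.t)) ≤ MQ) :
    Real.log (∑ m ∈ L.intF.support, |((coeff m L.intF : ℤ) : ℝ)|) ≤
      Real.log (Fintype.card (PhiRow D)).factorial +
        Fintype.card ↥(finsuppAntidiag (univ : Finset (Fin 3)) (2 * D)) * Real.log MP +
        Fintype.card ↥L.M₁ * Real.log MQ := by
  have hlen := L.length_intF_le
  have hlen1 := L.one_le_length_intF
  obtain ⟨N, hN⟩ : ∃ N : ℕ, N = Fintype.card (PhiRow D) := ⟨_, rfl⟩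
  obtain ⟨N₀, hN₀⟩ : ∃ N₀ : ℕ, N₀ = Fintype.card ↥(finsuppAntidiag (univ : Finset (Fin 3)) (2 * D)) :=
    ⟨_, rfl⟩
  obtain ⟨N₁, hN₁⟩ : ∃ N₁ : ℕ, N₁ = Fintype.card ↥L.M₁ := ⟨_, rfl⟩
  rw [← hN, ← hN₀, ← hN₁] at hlen ⊢
  have hfact : (0 : ℝ) < (N.factorial : ℝ) := Nat.cast_pos.mpr (Nat.factorial_pos N)
  have hMP0 : 0 < MP := lt_of_lt_of_le one_pos hMP
  have hMQ0 : 0 < MQ := lt_of_lt_of_le one_pos hMQ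
  have hP0 : 0 ≤ maxNorm (map (Int.castRingHom ℂ) Pt) := maxNorm_nonneg _
  have hQ0 : 0 ≤ maxNorm (map (Int.castRingHom ℂ) (levelQ D Pt L.t)) := maxNorm_nonneg _
  have hpowP : maxNorm (map (Int.castRingHom ℂ) Pt) ^ N₀ ≤ MP ^ N₀ := pow_le_pow_left₀ hP0 hP N₀
  have hpowQ : maxNorm (map (Int.castRingHom ℂ) (levelQ D Pt L.t)) ^ N₁ ≤ MQ ^ N₁ :=
    pow_le_pow_left₀ hQ0 hQ N₁
  have hlen2 : ∑ m ∈ L.intF.support, |((coeff m L.intF : ℤ) : ℝ)| ≤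
      (N.factorial : ℝ) * (MP ^ N₀ * MQ ^ N₁) := by
    refine hlen.trans (mul_le_mul_of_nonneg_left ?_ hfact.le)
    exact mul_le_mul hpowP hpowQ (pow_nonneg hQ0 _) (pow_nonneg hMP0.le _)
  have hpos1 : (0 : ℝ) < MP ^ N₀ := pow_pos hMP0 _
  have hpos2 : (0 : ℝ) < MQ ^ N₁ := pow_pos hMQ0 _
  calc Real.log (∑ m ∈ L.intF.support, |((coeff m L.intF : ℤ) : ℝ)|)
      ≤ Real.log ((N.factorial : ℝ) * (MP ^ N₀ * MQ ^ N₁)) :=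
        Real.log_le_log (lt_of_lt_of_le one_pos hlen1) hlen2
    _ = Real.log (N.factorial : ℝ) + N₀ * Real.log MP + N₁ * Real.log MQ := by
        rw [Real.log_mul hfact.ne' (mul_pos hpos1 hpos2).ne', Real.log_mul hpos1.ne' hpos2.ne',
          Real.log_pow, Real.log_pow, add_assoc]

/-- `log N! ≤ N log N`. [folklore] -/
theorem log_factorial_le (N : ℕ) : Real.log (N.factorial : ℝ) ≤ N * Real.log N := by
  rcases Nat.eq_zero_or_pos N with rfl | hN
  · simp
  · have h : (N.factorial : ℝ) ≤ (N : ℝ) ^ N := by exact_mod_cast Nat.factorial_le_pow N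
    calc Real.log (N.factorial : ℝ) ≤ Real.log ((N : ℝ) ^ N) :=
          Real.log_le_log (by exact_mod_cast Nat.factorial_pos N) h
      _ = N * Real.log N := Real.log_pow _ _

end LevelPkg

/-! ### The window -/

/-- `L ≤ T` on the window. [folklore] -/
theorem window_le {L T : ℕ} (hw : (L + 1).choose 2 < T) : L ≤ T := by
  rcases Nat.lt_or_ge L 2 with h | h
  · omega
  · have h1 : L ≤ (L + 1).choose 2 := by
      rw [Nat.choose_two_right]
      apply (Nat.le_div_iff_mul_le two_pos).mpr
      have : L + 1 - 1 = L := by omega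
      rw [this]; nlinarith
    omega

/-- `binom(L+2, 2) ≤ 3T` on the window. [folklore] -/
theorem choose_window_le {L T : ℕ} (hw : (L + 1).choose 2 < T) : (L + 2).choose 2 ≤ 3 * T := by
  have h : (L + 2).choose 2 = (L + 1).choose 1 + (L + 1).choose 2 := Nat.choose_succ_succ (L + 1) 1
  rw [Nat.choose_one_right] at h
  have := window_le hw
  omega

end Roy2013

end Literature.NumberTheory.Transcendental
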